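import Mathlib
import Summits.NavierStokesRegularity.NavierStokesRegularity.Theses.RootDecompLitSlice
import Summits.NavierStokesRegularity.NavierStokesRegularity.Theorems.RootDecompLitSliceGeneralWindowTradeoffClosed
import HarnessLib

/-!
# Route RootDecompLitSlice — support ST `ScarModulusTradeoff` CLOSED (stmt-NavierStokesRegularity-31791)

`Summit.NavierStokesRegularity.NavierStokesRegularity.Theses.RootDecompLitSlice.ScarModulusTradeoff`
— the SCAR–MODULUS TRADE-OFF with the PARABOLIC window (classical on `[0,T)`, Leray–Hopf on
`[0,T]`, rapidly decaying datum; `0 < r`, `r² < T`, `0 ≤ H`): if `∫|u(t) − u(T)|² ≤ H` for all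
`t ∈ [T − r², T)` then `∫_{B_r(x₀)}|u(T)|² ≤ 2H + (8‖u(0)‖₂/ν)√H` — is the case `τ = r²` of the
free-window trade-off STg `GeneralWindowTradeoff` ⟨27390⟩, now the kernel theorem
`Theorems.generalWindowTradeoff` (`RootDecompLitSliceGeneralWindowTradeoffClosed.lean`): `r²/r² = 1`.
This is the writer g32 kernel edge `WriterG32.scarModulusTradeoff_of_generalWindow` (evidence file
ScarExponentDial_g32.lean, sha256 a2b70d2daa73) with its hypothesis discharged.

HONEST FRAMING: ST is route-internal SUPPORT (rank 9; the first prover target of the clock split of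
U, critic row 563); it bears on no load of the route (ROOT ⟺ U ∧ P1). Rung 0: nothing here proves NS
regularity. Decomp-ns route-writer g36. [folklore]
-/

set_option linter.dupNamespace false

namespace Summit.NavierStokesRegularity.NavierStokesRegularity.Theorems

/-- **Support ST `ScarModulusTradeoff` of route RootDecompLitSlice, by name**: the parabolic window
`τ = r²` of the landed free-window trade-off `generalWindowTradeoff`. Route-internal support;
decorative for the summit (D-0179). [folklore] -/
theorem scarModulusTradeoff :
    Summit.NavierStokesRegularity.NavierStokesRegularity.Theses.RootDecompLitSlice.ScarModulusTradeoff := by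
  intro ν T hν hT u p hcl hLH hdec x₀ r H hr hrT hH hmod
  have h := generalWindowTradeoff ν T hν hT u p hcl hLH hdec x₀ r (r ^ 2) H hr (pow_pos hr 2) hrT hH
    hmod
  have hr2 : r ^ 2 / r ^ 2 = (1 : ℝ) := div_self (pow_pos hr 2).ne'
  rw [hr2, mul_one] at h
  exact h

end Summit.NavierStokesRegularity.NavierStokesRegularity.Theorems
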